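import Summits.BirchSwinnertonDyer.BirchSwinnertonDyer.Theorems.ErratumRoadFiveIMCDivClassicalAtomsB
import Summits.BirchSwinnertonDyer.Rank1Residual.X11b.RouteR1IntReceptacleOneSided
import Summits.BirchSwinnertonDyer.Rank1Residual.X1.UnrSeriesFirstUnitCoeff
import HarnessLib

/-!
# Route `ErratumRoadFive` (K2, `p ≥ 5`), the CLASSICAL-data no-road residuals (items 19282 `OpenInputNotRam`,
# 19702 `Rest3TorsionBranchAtFive`, 19703 `Rest3NoWitnessBranchAtFive`; deciding stub shape = the oriented
# value-free atom (2.4)∃♭ᴮ `P2.IMCDivSomeFrameOnTreeB W p`, bdp g16 p498117) — ROAD B12 «λ-MATCHING TRANSFER»: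
# the atom from an `R₀`-frame + ONE RATIONAL Euler-system divisibility + matching Iwasawa invariants

Cell `bsd-stepL` (run/shared/lean/pub/bsd-stepL/), seat `bsd-stepL-bdp` (prover g17, 2026-08-27).
`--supports stmt-BirchSwinnertonDyer-19282 --as helper`. THEOREMS ONLY; THESES-FREE (imports only the atom's
module, the `R₀ → 𝓞_{ℂ_p}` receptacle algebra and class X1's `R₀⟦T⟧` algebra), hence citable from K2's skeletons
and `closes` without pulling a route file into the cone (the `@3` twin p505319 imports two route files, so its
algebra lemma is NOT imported here; §1 states the IDEAL-level generalisation instead).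
Memo: HOME/proof/PROOF-BDP.md §37 (ROAD B12; brick table 37.2, column `p = 5`; Q37-1 answered §37.8).

The `p ≥ 5` twin of `Theorems/ClassRecordThreeIMCDivAtThreeLambdaMatchingCut.lean` (p505319, items 20262 ∕
20263 at `3 ∥ N`). THE ROAD (Greenberg–Vatsal ∕ Emerton–Pollack–Weston in the BDP currency): for E at `p ∥ N`
the EISENSTEIN-side inclusion `Ch_Λ(X_ac 𝔭bar)·R₀⟦T⟧ ⊆ (L)` follows — with EQUALITY — from ONE RATIONAL
divisibility on the EULER-SYSTEM side (`∃ k, p^k·L ∈ Ch·R₀⟦T⟧`; at `p ≥ 5`: Howard 2007 big Heegner points (PUB)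
+ Castella JIMJ 17 ∕ CJM 6 (2018) §§4–6 (PUB) + the `Λ`-adic explicit reciprocity law at `p ∥ N`, Castella
arXiv:2409.01360 Thm. 2.2 (PRE)) plus matching invariants (`μ = 0`, equal `λ`) transferred along `E[p] ≅ E′[p]`
from a `p`-congruent GOOD ORDINARY partner `E′` whose BDP main conjecture is REFEREED, (ram)-FREE print
(Burungale–Castella–Skinner, IMRN 2025, Thm. 1.2.4, tree `BurungaleCastellaSkinner2025/BDPMainConjecture.lean`;
partners abound at `p = 5`: `X_E(5) ≅ ℙ¹`, Rubin–Silverberg) by the printed `p ∤ N` templates Lei–Müller–Xia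
2023 Thm. 1 ∕ Nguyen arXiv:2503.00247 Thm. A, 7.5. Here: the kernel composition over the atom's own binders.

* §1 `LambdaMatching.ideal_map_eq_span_of_ratUpperBound_of_firstUnitCoeff` — the `R₀⟦T⟧` algebra for ANY
  principal ideal `I = (g)` of `Λ` (X1's `span_singleton_eq_of_C_pow_mul_mem`); the `@3` file's lemma is the
  instance `I := Ch_Λ(X)`.
* §2 `P2.exists_intFrame_forall_of_unrFrame_of_forall_le` — the LAST MILE for a whole family of X-slots: an
  `R₀`-frame with `Ch(X_ac 𝔮)·R₀⟦T⟧ ⊆ (L)` at every `𝔮` in a set, read in `𝓞_{ℂ_p}⟦T⟧` (multr1-p1's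
  `R1.isBDPLFunctionInt_map` + imc24c's `R1.ideal_map_le_span_map_of_le`).
* §3 **`P2.imcDivSomeFrameOnTreeB_of_unrFrame_of_ratUpperBound_of_invariantsMatch`** — the atom
  `P2.IMCDivSomeFrameOnTreeB W p` from THREE stub shapes over its own binders: FRAME (an `R₀`-frame at
  `(ι', 𝔭_{ι'})` — at `p ≥ 5` the printed A206 ∕ JIMJ18 display), UB (for every such frame and every
  `𝔭bar ≠ 𝔭_{ι'}`: `∃ k, p^k·L ∈ Ch(X_ac 𝔭bar)·R₀⟦T⟧`), INV (for every such frame and `𝔭bar`: a generator of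
  `Ch(X_ac 𝔭bar)` and `L` have their first unit coefficient at the same index); and
  `P2.charIdeal_map_eq_span_of_ratUpperBound_of_invariantsMatch` — the EQUALITY in `R₀⟦T⟧` at every frame.

HONEST FRAMING: implications only; UB at `p ∥ N` is PRE-grade at `p ≥ 5` (ERL) on Howard 2007's sub-locus
(`p ∤ 6·(N/p)·φ(N/p)`); INV's transfer needs the `p ∣ N` versions of LMX23 Thm. 1 ∕ Nguyen Thm. A (printed for
`p ∤ N` only; §37.8 shows the `𝔭bar`-local terms cancel WITHOUT (H0)) and a partner Heegner for the same `K` on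
the finite-flat sub-locus `p ∣ v_p(Δ_E)` (Q37-2). Nothing is discharged, booked or re-labelled (T7).

References: [Washington1997] Prop. 7.2, §13.2; [EmertonPollackWeston2006] Thm. 1; [GreenbergVatsal2000] §2;
[BurungaleCastellaSkinner2025] Thm. 1.2.4, Prop. 4.2.2; [LeiMullerXia2023] Thm. 1; arXiv:2503.00247 Thm. A, 7.5;
[Castella2018] Thm. 2.3, 3.1; [Castella2018Erratum] (2.4); cell audit ORIENT-AUDIT-19270 (form (a)).
-/

set_option autoImplicit false
set_option linter.dupNamespace false

noncomputable section

open scoped Classical NumberField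

open WeierstrassCurve NumberField IsDedekindDomain Field PowerSeries
open Literature.NumberTheory.EllipticCurves Literature.NumberTheory.EllipticCurves.GreenbergSelmer
open Literature.NumberTheory.EllipticCurves.ModularForms
open Literature.NumberTheory.EllipticCurves.Rank1Residual
open Literature.NumberTheory.EllipticCurves.Castella2018
open Literature.NumberTheory.GaloisRepresentations Literature.NumberTheory.GaloisCohomology
open Summit.BirchSwinnertonDyer.Rank1Residual.X11b.AcSelmer
open Summit.BirchSwinnertonDyer.Rank1Residual.X11b.Halves
open Summit.BirchSwinnertonDyer.Rank1Residual.X1.KellerYinHalves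

/-! ### §1 The `R₀⟦T⟧` algebra of λ-matching, for any principal ideal of `Λ` -/

namespace Summit.BirchSwinnertonDyer.BirchSwinnertonDyer.Theorems.LambdaMatching

/-- **λ-matching ⟹ EQUALITY of ideals** in `R₀⟦T⟧` (Greenberg–Vatsal ∕ Emerton–Pollack–Weston's last step): for
an ideal `I = (g)` of `Λ = ℤ_p⟦T⟧`, if the images of `g` and of `L ∈ R₀⟦T⟧` both have `μ = 0` with their first unit
coefficient at the same index `n` (`λ = n`) and ONE divisibility holds after inverting `p`
(`p^k · L ∈ I·R₀⟦T⟧`), then `I·R₀⟦T⟧ = (L)`. Pure algebra over the complete DVR `R₀`.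
[cite: Washington1997, §7.1 Prop. 7.2 and §13.2] [cite: EmertonPollackWeston2006, Thm. 1 (the mechanism)] -/
theorem ideal_map_eq_span_of_ratUpperBound_of_firstUnitCoeff {p : ℕ} [Fact p.Prime]
    {I : Ideal (IwasawaAlgebra p)} {g : IwasawaAlgebra p} (hg : I = Ideal.span {g})
    {L : UnrSeries p} {k n : ℕ}
    (hUB : C (((p : ℕ) : unrIntegers p) ^ k) * L ∈ I.map (PowerSeries.map (toUnr p)))
    (hFg : ‖((coeff n (PowerSeries.map (toUnr p) g) : unrIntegers p) : ℂ_[p])‖ = 1 ∧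
      ∀ i < n, ‖((coeff i (PowerSeries.map (toUnr p) g) : unrIntegers p) : ℂ_[p])‖ < 1)
    (hFL : ‖((coeff n L : unrIntegers p) : ℂ_[p])‖ = 1 ∧
      ∀ i < n, ‖((coeff i L : unrIntegers p) : ℂ_[p])‖ < 1) :
    I.map (PowerSeries.map (toUnr p)) = Ideal.span {L} := by
  subst hg
  rw [Ideal.map_span, Set.image_singleton] at hUB ⊢
  exact span_singleton_eq_of_C_pow_mul_mem hUB hFg hFL

end Summit.BirchSwinnertonDyer.BirchSwinnertonDyer.Theorems.LambdaMatching

namespace Summit.BirchSwinnertonDyer.Rank1Residual.X11b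

open Summit.BirchSwinnertonDyer.BirchSwinnertonDyer.Theorems.LambdaMatching

/-! ### §2 The last mile for a family of X-slots -/

/-- **`R₀`-frame + divisibility at every X-slot in a set ⟹ the `𝓞_{ℂ_p}⟦T⟧`-frame shape of the classical
B-atoms** (read `L` in `𝓞_{ℂ_p}⟦T⟧`: `R1.isBDPLFunctionInt_map`; transport each inclusion along `R₀ ⊆ 𝓞_{ℂ_p}`:
`R1.ideal_map_le_span_map_of_le`). Unconditional. [cite: Castella2018Erratum, (2.4) (p. 4)]
[cite: Castella2018, Thm. 3.1 (arXiv:1704.06608 p. 9)] -/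
theorem P2.exists_intFrame_forall_of_unrFrame_of_forall_le {K : Type} [Field K] [NumberField K]
    (W : WeierstrassCurve ℚ) (p : ℕ) [Fact p.Prime] (κ : ZpExtension K p) (γ : Field.absoluteGaloisGroup K)
    [Fact (κ.IsTopGenerator γ)] (ι : PadicAlgCl p ≃+* ℂ) (𝔭 : HeightOneSpectrum (𝓞 K)) {N : ℕ}
    (f : CuspForm (CongruenceSubgroup.Gamma0 N) 2) (S : Set (HeightOneSpectrum (𝓞 K)))
    {ΩK : ℂ} {Ωp : (unrIntegers p)ˣ} {L : UnrSeries p} (hΩ : ΩK ≠ 0)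
    (hL : IsBDPLFunction ι 𝔭 κ γ f ΩK ((Ωp : unrIntegers p) : ℂ_[p]) L)
    (hdiv : ∀ 𝔮 ∈ S, (XAc.charIdeal (W.baseChange K) p κ 𝔮 ∅ γ).map (PowerSeries.map (toUnr p)) ≤
      Ideal.span {L}) :
    ∃ (ΩK : ℂ) (Ωp : ℂ_[p]) (Q : PowerSeries 𝓞_ℂ_[p]), ΩK ≠ 0 ∧ ‖Ωp‖ = 1 ∧
      R1.IsBDPLFunctionInt p ι 𝔭 κ γ f ΩK Ωp Q ∧
      ∀ 𝔮 ∈ S, (XAc.charIdeal (W.baseChange K) p κ 𝔮 ∅ γ).map (PowerSeries.map (R1.toCpInt p)) ≤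
        Ideal.span {Q} :=
  ⟨ΩK, ((Ωp : unrIntegers p) : ℂ_[p]), PowerSeries.map (R1.unrToCpInt p) L, hΩ,
    norm_coe_units_unrIntegers p Ωp, R1.isBDPLFunctionInt_map hL,
    fun 𝔮 h𝔮 ↦ R1.ideal_map_le_span_map_of_le p (hdiv 𝔮 h𝔮)⟩

/-! ### §3 The atom `P2.IMCDivSomeFrameOnTreeB W p` from FRAME + UB + INV -/

variable {W : WeierstrassCurve ℚ} {p : ℕ} [Fact p.Prime]

/-- **ROAD B12 at `p ≥ 5`, classical data: the EQUALITY `Ch_Λ(X_ac 𝔭bar)·R₀⟦T⟧ = (L)`** for an `R₀`-frame `L` at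
`(ι', 𝔭_{ι'})` and an X-slot `𝔭bar ≠ 𝔭_{ι'}`, from UB (`∃ k, p^k·L ∈ Ch·R₀⟦T⟧`) and INV (a generator of `Ch`
and `L` have their first unit coefficient at the same index). Pure algebra; CONDITIONAL on the two shapes.
[cite: Washington1997, §7.1 Prop. 7.2 and §13.2] [cite: EmertonPollackWeston2006, Thm. 1 (mechanism)] -/
theorem P2.charIdeal_map_eq_span_of_ratUpperBound_of_invariantsMatch {K : Type} [Field K] [NumberField K]
    (κ : ZpExtension K p) (γ : Field.absoluteGaloisGroup K) [Fact (κ.IsTopGenerator γ)]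
    (𝔭bar : HeightOneSpectrum (𝓞 K)) {L : UnrSeries p}
    (hUB : ∃ k : ℕ, C (((p : ℕ) : unrIntegers p) ^ k) * L ∈
      (XAc.charIdeal (W.baseChange K) p κ 𝔭bar ∅ γ).map (PowerSeries.map (toUnr p)))
    (hINV : ∃ (g : IwasawaAlgebra p) (n : ℕ),
      XAc.charIdeal (W.baseChange K) p κ 𝔭bar ∅ γ = Ideal.span {g} ∧
      (‖((coeff n (PowerSeries.map (toUnr p) g) : unrIntegers p) : ℂ_[p])‖ = 1 ∧
        ∀ i < n, ‖((coeff i (PowerSeries.map (toUnr p) g) : unrIntegers p) : ℂ_[p])‖ < 1) ∧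
      (‖((coeff n L : unrIntegers p) : ℂ_[p])‖ = 1 ∧
        ∀ i < n, ‖((coeff i L : unrIntegers p) : ℂ_[p])‖ < 1)) :
    (XAc.charIdeal (W.baseChange K) p κ 𝔭bar ∅ γ).map (PowerSeries.map (toUnr p)) = Ideal.span {L} := by
  obtain ⟨k, hk⟩ := hUB
  obtain ⟨g, n, hg, hFg, hFL⟩ := hINV
  exact ideal_map_eq_span_of_ratUpperBound_of_firstUnitCoeff hg hk hFg hFL

/-- **ROAD B12 at `p ≥ 5`: the oriented classical atom (2.4)∃♭ᴮ `P2.IMCDivSomeFrameOnTreeB W p` from FRAME +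
UB + INV** over its own binders — FRAME: an `R₀`-frame `(Ω_K ≠ 0, Ω_p ∈ R₀ˣ, L)` with Castella's interpolation
property at `(ι', 𝔭_{ι'})` (at `p ≥ 5` the printed A206 ∕ JIMJ18 display); UB: for every such frame and every
`𝔭bar ∋ p`, `𝔭bar ≠ 𝔭_{ι'}`, ONE RATIONAL Euler-system divisibility `∃ k, p^k·L ∈ Ch(X_ac 𝔭bar)·R₀⟦T⟧`; INV:
for every such frame and `𝔭bar`, matching first unit coefficients. The divisibility conjunct of the atom then
holds with EQUALITY in `R₀⟦T⟧` and is read in `𝓞_{ℂ_p}⟦T⟧` by §2. CONDITIONAL on all three; nothing booked.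
[cite: Castella2018Erratum, (2.4) (p. 4) (the atom's display)] [cite: Castella2018, Thm. 3.1 (arXiv:1704.06608 p. 9)]
[cite: Washington1997, §7.1 Prop. 7.2 and §13.2] [cite: BurungaleCastellaSkinner2025, Thm. 1.2.4 (the partner's equality at p ≥ 5)] -/
theorem P2.imcDivSomeFrameOnTreeB_of_unrFrame_of_ratUpperBound_of_invariantsMatch
    (hFRAME : ∀ (N : ℕ) [NeZero N] (K : Type) [Field K] [NumberField K]
      (Dt : ModularParametrizationData W N) (H : HeegnerDatum N (NumberField.discr K)) (ι : K →+* ℂ)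
      (P : (W.baseChange K).toAffine.Point),
      ClassX11b W p → 5 ≤ p → Surj W p → W.conductorNorm ℤ = N → IsImaginaryQuadratic K →
      Odd (NumberField.discr K) → ¬ (p : ℤ) ∣ NumberField.discr K → ¬ p ∣ Units.torsionOrder K →
      SatisfiesHeegnerHypothesis N K →
      (W.quadraticTwist (NumberField.discr K : ℚ)).entireLFunction 1 ≠ 0 →
      WeierstrassCurve.Affine.Point.map ι.toRatAlgHom P = heegnerPointComplex Dt H →
      ¬ (p : ℤ) ∣ Dt.c → ¬ IsOfFinAddOrder P →
      ∀ (κ : ZpExtension K p), κ.IsAnticyclotomic →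
        ∀ (γ : Field.absoluteGaloisGroup K) [Fact (κ.IsTopGenerator γ)]
          (ι' : PadicAlgCl p ≃+* ℂ) (w₀ : InfinitePlace K) (P' : (W.baseChange K).toAffine.Point),
          WeierstrassCurve.Affine.Point.map w₀.embedding.toRatAlgHom P' = heegnerPointComplex Dt H →
          ∀ (e : K →+* ℚ_[p]),
            (∀ k : 𝓞 K, k ∈ (primeOfEmbeddingDatum p ι' w₀.embedding).asIdeal ↔ ‖e (k : K)‖ < 1) →
            ∃ (ΩK : ℂ) (Ωp : (unrIntegers p)ˣ) (L : UnrSeries p), ΩK ≠ 0 ∧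
              IsBDPLFunction ι' (primeOfEmbeddingDatum p ι' w₀.embedding) κ γ Dt.f ΩK
                ((Ωp : unrIntegers p) : ℂ_[p]) L)
    (hUB : ∀ (N : ℕ) [NeZero N] (K : Type) [Field K] [NumberField K]
      (Dt : ModularParametrizationData W N) (H : HeegnerDatum N (NumberField.discr K)) (ι : K →+* ℂ)
      (P : (W.baseChange K).toAffine.Point),
      ClassX11b W p → 5 ≤ p → Surj W p → W.conductorNorm ℤ = N → IsImaginaryQuadratic K →
      Odd (NumberField.discr K) → ¬ (p : ℤ) ∣ NumberField.discr K → ¬ p ∣ Units.torsionOrder K →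
      SatisfiesHeegnerHypothesis N K →
      (W.quadraticTwist (NumberField.discr K : ℚ)).entireLFunction 1 ≠ 0 →
      WeierstrassCurve.Affine.Point.map ι.toRatAlgHom P = heegnerPointComplex Dt H →
      ¬ (p : ℤ) ∣ Dt.c → ¬ IsOfFinAddOrder P →
      ∀ (κ : ZpExtension K p), κ.IsAnticyclotomic →
        ∀ (γ : Field.absoluteGaloisGroup K) [Fact (κ.IsTopGenerator γ)]
          (ι' : PadicAlgCl p ≃+* ℂ) (w₀ : InfinitePlace K) (P' : (W.baseChange K).toAffine.Point),
          WeierstrassCurve.Affine.Point.map w₀.embedding.toRatAlgHom P' = heegnerPointComplex Dt H →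
          ∀ (e : K →+* ℚ_[p]),
            (∀ k : 𝓞 K, k ∈ (primeOfEmbeddingDatum p ι' w₀.embedding).asIdeal ↔ ‖e (k : K)‖ < 1) →
            ∀ (ΩK : ℂ) (Ωp : (unrIntegers p)ˣ) (L : UnrSeries p), ΩK ≠ 0 →
              IsBDPLFunction ι' (primeOfEmbeddingDatum p ι' w₀.embedding) κ γ Dt.f ΩK
                ((Ωp : unrIntegers p) : ℂ_[p]) L →
              ∀ (𝔭bar : HeightOneSpectrum (𝓞 K)), ((p : ℕ) : 𝓞 K) ∈ 𝔭bar.asIdeal →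
                𝔭bar ≠ primeOfEmbeddingDatum p ι' w₀.embedding →
                ∃ k : ℕ, C (((p : ℕ) : unrIntegers p) ^ k) * L ∈
                  (XAc.charIdeal (W.baseChange K) p κ 𝔭bar ∅ γ).map (PowerSeries.map (toUnr p)))
    (hINV : ∀ (N : ℕ) [NeZero N] (K : Type) [Field K] [NumberField K]
      (Dt : ModularParametrizationData W N) (H : HeegnerDatum N (NumberField.discr K)) (ι : K →+* ℂ)
      (P : (W.baseChange K).toAffine.Point),
      ClassX11b W p → 5 ≤ p → Surj W p → W.conductorNorm ℤ = N → IsImaginaryQuadratic K →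
      Odd (NumberField.discr K) → ¬ (p : ℤ) ∣ NumberField.discr K → ¬ p ∣ Units.torsionOrder K →
      SatisfiesHeegnerHypothesis N K →
      (W.quadraticTwist (NumberField.discr K : ℚ)).entireLFunction 1 ≠ 0 →
      WeierstrassCurve.Affine.Point.map ι.toRatAlgHom P = heegnerPointComplex Dt H →
      ¬ (p : ℤ) ∣ Dt.c → ¬ IsOfFinAddOrder P →
      ∀ (κ : ZpExtension K p), κ.IsAnticyclotomic →
        ∀ (γ : Field.absoluteGaloisGroup K) [Fact (κ.IsTopGenerator γ)]
          (ι' : PadicAlgCl p ≃+* ℂ) (w₀ : InfinitePlace K) (P' : (W.baseChange K).toAffine.Point),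
          WeierstrassCurve.Affine.Point.map w₀.embedding.toRatAlgHom P' = heegnerPointComplex Dt H →
          ∀ (e : K →+* ℚ_[p]),
            (∀ k : 𝓞 K, k ∈ (primeOfEmbeddingDatum p ι' w₀.embedding).asIdeal ↔ ‖e (k : K)‖ < 1) →
            ∀ (ΩK : ℂ) (Ωp : (unrIntegers p)ˣ) (L : UnrSeries p), ΩK ≠ 0 →
              IsBDPLFunction ι' (primeOfEmbeddingDatum p ι' w₀.embedding) κ γ Dt.f ΩK
                ((Ωp : unrIntegers p) : ℂ_[p]) L →
              ∀ (𝔭bar : HeightOneSpectrum (𝓞 K)), ((p : ℕ) : 𝓞 K) ∈ 𝔭bar.asIdeal →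
                𝔭bar ≠ primeOfEmbeddingDatum p ι' w₀.embedding →
                ∃ (g : IwasawaAlgebra p) (n : ℕ),
                  XAc.charIdeal (W.baseChange K) p κ 𝔭bar ∅ γ = Ideal.span {g} ∧
                  (‖((coeff n (PowerSeries.map (toUnr p) g) : unrIntegers p) : ℂ_[p])‖ = 1 ∧
                    ∀ i < n, ‖((coeff i (PowerSeries.map (toUnr p) g) : unrIntegers p) : ℂ_[p])‖ < 1) ∧
                  (‖((coeff n L : unrIntegers p) : ℂ_[p])‖ = 1 ∧
                    ∀ i < n, ‖((coeff i L : unrIntegers p) : ℂ_[p])‖ < 1)) :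
    P2.IMCDivSomeFrameOnTreeB W p := by
  intro N _ K _ _ Dt H ι P hX h5 hs hN hK hodd hpd hμ hHN hLt hP hc hPinf κ hκ γ _ ι' w₀ P' hP' e he
  obtain ⟨ΩK, Ωp, L, hΩK, hL⟩ :=
    hFRAME N K Dt H ι P hX h5 hs hN hK hodd hpd hμ hHN hLt hP hc hPinf κ hκ γ ι' w₀ P' hP' e he
  have hle : ∀ 𝔮 ∈ {𝔮 : HeightOneSpectrum (𝓞 K) | ((p : ℕ) : 𝓞 K) ∈ 𝔮.asIdeal ∧
      𝔮 ≠ primeOfEmbeddingDatum p ι' w₀.embedding},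
      (XAc.charIdeal (W.baseChange K) p κ 𝔮 ∅ γ).map (PowerSeries.map (toUnr p)) ≤ Ideal.span {L} := by
    intro 𝔮 h𝔮
    obtain ⟨h𝔮p, hne⟩ := h𝔮
    exact (P2.charIdeal_map_eq_span_of_ratUpperBound_of_invariantsMatch κ γ 𝔮
      (hUB N K Dt H ι P hX h5 hs hN hK hodd hpd hμ hHN hLt hP hc hPinf κ hκ γ ι' w₀ P' hP' e he ΩK Ωp L
        hΩK hL 𝔮 h𝔮p hne)
      (hINV N K Dt H ι P hX h5 hs hN hK hodd hpd hμ hHN hLt hP hc hPinf κ hκ γ ι' w₀ P' hP' e he ΩK Ωp L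
        hΩK hL 𝔮 h𝔮p hne)).le
  obtain ⟨ΩK₁, Ωp₁, Q, hΩK₁, hΩp₁, hQ, hdiv⟩ :=
    P2.exists_intFrame_forall_of_unrFrame_of_forall_le W p κ γ ι' (primeOfEmbeddingDatum p ι' w₀.embedding)
      Dt.f _ hΩK hL hle
  exact ⟨ΩK₁, Ωp₁, Q, hΩK₁, hΩp₁, hQ, fun 𝔭bar h𝔭bar hne ↦ hdiv 𝔭bar ⟨h𝔭bar, hne⟩⟩

end Summit.BirchSwinnertonDyer.Rank1Residual.X11b

end
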